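import Summits.QuantumFields.BalabanUV.Beta.RootedMixedJetLinear
import Summits.QuantumFields.BalabanUV.Beta.RootedJetReflection

/-!
# `BalabanUV.Beta.RootedMixedJetReflectionLaw` — THE AXIS-REFLECTION LAWS OF NODE 12b's ROOTED MIXED JET `MjetAt`
# (β sub-cell, row D1 letter chain HR-W-LET, MIXED sub-chain M2 toward the level-0 mixed identity (M₀); an3 gen 33)

HONEST FRAMING (cell charter, verbatim): «discharging BetaPertH makes Bałaban's UV stability UNCONDITIONAL — a real
constructive-QFT result; it is NOT the continuum limit and NOT the Clay problem.»  HONEST DEPENDENCY (verbatim): «continuum YM on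
T⁴ ⇐ BetaPertH ∧ nine spine estimates (0/9 proved); BetaPertH ⇐ (D1) ∧ (D4) ∧ CAP+tail; G-an2-4 gates asym, D1 and NE2/3/4.»
DERIVED cell leaf: [folklore] ring algebra assembling leaf-05-g7's MX1 `RootedMixedChartReflection` (chart-level laws `PhiMAt_sref_of_ne`,
`PhiMLAt_reflPair_self_eq_invT`, reflected letters `reflPair_Zf_Zb`, `BR_self_R1g`, `Zb_mul_ι_mul_Zf`), 33M1 `RootedMixedJetLinear`
(joint additivity ∕ centrality ∕ reference shift of the two-background σ-jet `MσGAt`) and 33D `RootedJetReflection` §4 (the Lie-level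
shadow of inversion `logT_invT_mul_invT_invT`), all BY NAME.  No statement of Bałaban's papers is typed, no `[cite:]`, no `Prop` is minted,
no binder of the β-function wall (`hW`/`hR`/`D1Tel`/`D1Rep`, (D1), `BetaPertH`) is instantiated or discharged.  NOT summit progress.

## What this module proves (centred root `ctr d L`, `L` odd, `(2 : 𝕜) ≠ 0`; reflected axis `α`, `w, v, b̃ := R1g α W, R1g α V, R1g α B`)

* §1 `Zf 0 0 = 1 = Zb 0 0`, `R1g α 0 = 0`, `BR α 0 0 B = upF b̃`, the AXIS CORRECTION `DR α W V B := BR α W V B − upF b̃` of the reflected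
  background (supported on `κ = α`), `fst`∕`snd` bookkeeping in `Rho 𝔸` (`fst_PhiMLAt`, `fst_PhiMAt_zero_zero = 1`, `invT` at `fst = 1`).
* §2 **TRANSVERSE LAW (`μ ≠ α`)**: `MjetAt W V B L μ (sref α y) = MjetAt w v b̃ L μ y + c11 (MσGAt (Zf w v) (Zb w v) (DR α W V B) (Zf 0 0) (Zb 0 0) 0 L μ y)`
  (`MjetAt_sref_of_ne`): the pulled-back jet PLUS the un-normalised σ-jet of the axis correction (33M1's reference shift), with its
  `Tau`-level form `Mσ_sref_of_ne`.
* §3 **LONGITUDINAL LAW (`μ = α`, `y′ := bref α α y`)**: the SAME left-chart jet of the reflected data at `(α, y)` equals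
  `−( Mσ(W,V,B)(α,y′) + [ (logT Φ).fst , Φ₀.snd ] )`, `Φ = PhiMAt W V B L α y′`, `Φ₀ = PhiMAt 0 0 B L α y′` (`Mσ_reflPair_self`): minus the
  original σ-jet, minus the COMMUTATOR of the pure-fluctuation logarithm with the linear background average (the reference `Φ₀` has trivial
  group part but a σ-part) — hence `MjetAt W V B L α y′ = −(MjetAt w v b̃ L α y + c11 (MσGAt … DR … 0 L α y) + c11 [ (logT Φ).fst, Φ₀.snd ])`
  (`MjetAt_bref_self`).
* §4 THE AXIS CORRECTION IN COMPONENTS: `DR = τ₁·ι D1R + τ₂·ι D2R + τ₁τ₂·ι D12R` with `D1R = [b̃, w]`, `D2R = [b̃, v]`,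
  `D12R = ½{w,v}b̃ + b̃½{w,v} − w b̃ v − v b̃ w` ON the axis (`0` off it), and the CONTACT EXPANSION
  `c11 (MσGAt … DR … 0) = c01 (MσGAt … (upF D1R) … 0) + c10 (MσGAt … (upF D2R) … 0) + c00 (MσGAt … (upF D12R) … 0)` (`c11_MσGAt_DR`).

## What is NOT here
No table (`aTab`∕`apTab`∕`tTab`∕`mixFFAt`) is evaluated and no packed identity is stated: the identification of the contact jets and of the
commutator with node 7aρ∕12b's `hessFFAt`∕`linKerAt`∕`ctGen` (an1-g28's normal form `hM_an1`, leaf-05-g7's packing adapter) is M3∕M4.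
-/

namespace Summit.QuantumFields.BalabanUV.Beta.RootedMixedJetReflectionLaw

open Literature.MathematicalPhysics.QuantumFieldTheory.Balaban1983to89
open Literature.MathematicalPhysics.QuantumFieldTheory.Balaban1983to89.Beta
open AffineAveraging (Form1)
open AveragingContoursRooted (ctr)
open AveragingThirdJet (Tau Rho dmk fst_dmk snd_dmk dfst_mul dsnd_mul upF upF_apply logT invT map_logT map_invT invT_one logT_one
  ι_zero)
open AveragingThirdJet.Tau (τ₁ τ₂ τ12 ι c00 c10 c01 c11 mk ext4 c11_add c11_neg c11_τ₁_mul c11_τ₂_mul c11_τ12_mul τ₁_comm τ₂_comm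
  τ12_comm)
open AveragingMixedJetTables (PhiGAt map_PhiGAt PhiGAt_one Zf Zb Gm Gmb PhiMAt MjetAt)
open ResolventReflection (sref bref bref_of_ne bref_self)
open Summit.QuantumFields.BalabanUV.Beta.RootedHolonomyReflection (R1g R1g_of_ne)
open Summit.QuantumFields.BalabanUV.Beta.RootedHolonomyReflectionHol (reflPair reflPair_of_ne reflPair_self)
open Summit.QuantumFields.BalabanUV.Beta.TruncatedNil4Calculus (nil4_augR aug_PhiGAt_eq_one)
open Summit.QuantumFields.BalabanUV.Beta.RootedMixedChartReflection (GmL GmbL PhiMLAt MσLAt MjetLAt fst_GmL snd_GmL fst_GmbL snd_GmbL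
  PhiMAt_eq_PhiMLAt MjetAt_eq_MjetLAt MjetLAt_eq_c11 BR BR_of_ne_R1g BR_self_R1g reflPair_Zf_Zb reflPair_Zb_Zf PhiMAt_sref_of_ne
  PhiMLAt_reflPair_self_eq_invT augR_Gm augR_Gmb Zb_mul_ι_mul_Zf)
open Summit.QuantumFields.BalabanUV.Beta.RootedMixedJetLinear (MσGAt MσLAt_eq_MσGAt MσGAt_eq_MσLAt_add MσGAt_add_zero
  MσGAt_mul_central_zero)
open Summit.QuantumFields.BalabanUV.Beta.RootedJetReflection (logT_invT_mul_invT_invT)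

variable {𝕜 : Type*} [Field 𝕜] {d : ℕ} {𝔸 : Type*} [Ring 𝔸] [Algebra 𝕜 𝔸]

/-! ## §1 Letters at zero fluctuation, the axis correction `DR`, and `fst`∕`snd` bookkeeping in `Rho 𝔸` -/

/-- [folklore] `Zf 0 0 = 1`. -/
theorem Zf_zero : Zf 𝕜 (0 : Form1 d 𝔸) 0 = fun _ _ => 1 := by
  funext κ x; exact ext4 (by simp [Zf]) (by simp [Zf]) (by simp [Zf]) (by simp [Zf])

/-- [folklore] `Zb 0 0 = 1`. -/
theorem Zb_zero : Zb 𝕜 (0 : Form1 d 𝔸) 0 = fun _ _ => 1 := by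
  funext κ x; exact ext4 (by simp [Zb]) (by simp [Zb]) (by simp [Zb]) (by simp [Zb])

omit [Algebra 𝕜 𝔸] in
/-- [folklore] `R1g α 0 = 0`. -/
theorem R1g_zero {R : Type*} [AddCommGroup R] (α : Fin d) : R1g α (0 : Form1 d R) = 0 := by
  funext κ x; by_cases h : κ = α <;> simp [R1g, h]

/-- [folklore] At zero fluctuation the reflected background is the plain signed pull-back: `BR α 0 0 B = upF (R1g α B)`. -/
theorem BR_zero_zero (α : Fin d) (B : Form1 d 𝔸) : BR (𝕜 := 𝕜) α 0 0 B = upF (R1g α B) := by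
  funext κ x
  by_cases h : κ = α
  · subst h
    rw [BR_self_R1g, R1g_zero, Zb_zero, Zf_zero, upF_apply, one_mul, mul_one]
  · rw [BR_of_ne_R1g h, upF_apply]

/-- [folklore] THE AXIS CORRECTION of the reflected background letter: `DR := BR − upF (R1g α B)` (zero off the axis). -/
noncomputable def DR (α : Fin d) (W V B : Form1 d 𝔸) : Form1 d (Tau 𝔸) := fun κ x => BR (𝕜 := 𝕜) α W V B κ x - ι (R1g α B κ x)

/-- [folklore] `BR = upF (R1g α B) + DR`. -/
theorem BR_eq_upF_add_DR (α : Fin d) (W V B : Form1 d 𝔸) :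
    BR (𝕜 := 𝕜) α W V B = upF (R1g α B) + DR (𝕜 := 𝕜) α W V B := by
  funext κ x; simp [DR]

/-- [folklore] `DR` vanishes off the axis. -/
theorem DR_of_ne {α κ : Fin d} (h : κ ≠ α) (W V B : Form1 d 𝔸) (x : Fin d → ℤ) : DR (𝕜 := 𝕜) α W V B κ x = 0 := by
  rw [DR, BR_of_ne_R1g h, sub_self]

/-- [folklore] `DR` on the axis: `Zb(w,v)·ι b̃·Zf(w,v) − ι b̃` at the reflected letters. -/
theorem DR_self (α : Fin d) (W V B : Form1 d 𝔸) (x : Fin d → ℤ) :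
    DR (𝕜 := 𝕜) α W V B α x = Zb 𝕜 (R1g α W) (R1g α V) α x * ι (R1g α B α x) * Zf 𝕜 (R1g α W) (R1g α V) α x - ι (R1g α B α x) := by
  rw [DR, BR_self_R1g]

/-- [folklore] The group part of the mixed left-chart averaging is the averaging of the fluctuation pair (independent of the background). -/
theorem fst_PhiMLAt (ρ : Fin d → ℤ) (Z Zb' b : Form1 d (Tau 𝔸)) (L : ℕ) (μ : Fin d) (y : Fin d → ℤ) :
    (PhiMLAt 𝕜 ρ Z Zb' b L μ y).fst = PhiGAt 𝕜 ρ Z Zb' L μ y := by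
  have h := map_PhiGAt (TrivSqZeroExt.fstHom 𝕜 (Tau 𝔸) (Tau 𝔸)) ρ (GmL Z b) (GmbL Zb' b) L μ y
  simp only [TrivSqZeroExt.fstHom_apply, fst_GmL, fst_GmbL] at h
  exact h

/-- [folklore] The group part of node 12b's mixed averaging is the averaging of `(Zf W V, Zb W V)`. -/
theorem fst_PhiMAt (ρ : Fin d → ℤ) (W V B : Form1 d 𝔸) (L : ℕ) (μ : Fin d) (y : Fin d → ℤ) :
    (PhiMAt 𝕜 ρ W V B L μ y).fst = PhiGAt 𝕜 ρ (Zf 𝕜 W V) (Zb 𝕜 W V) L μ y := by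
  rw [PhiMAt_eq_PhiMLAt, fst_PhiMLAt]

/-- [folklore] The pure-background mixed averaging has TRIVIAL group part. -/
theorem fst_PhiMAt_zero_zero (ρ : Fin d → ℤ) (B : Form1 d 𝔸) (L : ℕ) (μ : Fin d) (y : Fin d → ℤ) :
    (PhiMAt 𝕜 ρ 0 0 B L μ y).fst = 1 := by
  rw [fst_PhiMAt, Zf_zero, Zb_zero, PhiGAt_one]

/-- [folklore] `fst ∘ logT = logT ∘ fst` on `Rho 𝔸`. -/
theorem fst_logT (X : Rho 𝔸) : (logT 𝕜 X).fst = logT 𝕜 X.fst := by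
  have h := map_logT (TrivSqZeroExt.fstHom 𝕜 (Tau 𝔸) (Tau 𝔸)) X
  simpa only [TrivSqZeroExt.fstHom_apply] using h

omit [Algebra 𝕜 𝔸] in
/-- [folklore] `invT (1 + σ s) = 1 − σ s`: group part. -/
theorem fst_invT_of_fst_eq_one {X : Rho 𝔸} (h : X.fst = 1) : (invT X).fst = 1 := by
  simp [invT, h]

omit [Algebra 𝕜 𝔸] in
/-- [folklore] `invT (1 + σ s) = 1 − σ s`: σ-part. -/
theorem snd_invT_of_fst_eq_one {X : Rho 𝔸} (h : X.fst = 1) : (invT X).snd = -X.snd := by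
  simp [invT, h]

omit [Algebra 𝕜 𝔸] in
/-- [folklore] The σ-part of `−(invT Φ₀ · J · Φ₀)` for a reference `Φ₀` of trivial group part: `−(J.snd + [J.fst, Φ₀.snd])`. -/
theorem snd_neg_invT_mul_mul {J Φ₀ : Rho 𝔸} (h0 : Φ₀.fst = 1) :
    (-(invT Φ₀ * J * Φ₀)).snd = -(J.snd + (J.fst * Φ₀.snd - Φ₀.snd * J.fst)) := by
  rw [TrivSqZeroExt.snd_neg, dsnd_mul, dsnd_mul, dfst_mul, fst_invT_of_fst_eq_one h0, snd_invT_of_fst_eq_one h0, h0, one_mul,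
    one_mul, mul_one, neg_mul]
  abel

/-! ## §2 The transverse law `μ ≠ α` -/

section Transverse

variable {L : ℕ} (hL : Odd L) (h2 : (2 : 𝕜) ≠ 0)
include hL h2

/-- [folklore] `μ ≠ α`, RAW FORM: the σ-jet of the original data at the reflected coarse bond `(μ, sref α y)` IS the two-background σ-jet of
the reflected letters `(Zf w v, Zb w v; BR)` against the reference `(1, 1; upF b̃)` at `(μ, y)`. -/
theorem Mσ_sref_of_ne {α μ : Fin d} (h : μ ≠ α) (W V B : Form1 d 𝔸) (y : Fin d → ℤ) :
    (logT 𝕜 (PhiMAt 𝕜 (ctr d L) W V B L μ (sref α y) * invT (PhiMAt 𝕜 (ctr d L) 0 0 B L μ (sref α y)))).snd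
      = MσGAt 𝕜 (ctr d L) (Zf 𝕜 (R1g α W) (R1g α V)) (Zb 𝕜 (R1g α W) (R1g α V)) (BR (𝕜 := 𝕜) α W V B)
          (Zf 𝕜 0 0) (Zb 𝕜 0 0) (upF (R1g α B)) L μ y := by
  rw [PhiMAt_sref_of_ne hL h2 h, PhiMAt_sref_of_ne hL h2 h, reflPair_Zf_Zb, reflPair_Zb_Zf, reflPair_Zf_Zb, reflPair_Zb_Zf,
    R1g_zero, BR_zero_zero, MσGAt]

/-- [folklore] **`μ ≠ α`: THE TRANSVERSE REFLECTION LAW OF THE ROOTED MIXED σ-JET** — pulled-back jet PLUS the un-normalised σ-jet of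
the axis correction `DR` (33M1's reference shift). -/
theorem Mσ_sref_of_ne_eq_add {α μ : Fin d} (h : μ ≠ α) (W V B : Form1 d 𝔸) (y : Fin d → ℤ) :
    (logT 𝕜 (PhiMAt 𝕜 (ctr d L) W V B L μ (sref α y) * invT (PhiMAt 𝕜 (ctr d L) 0 0 B L μ (sref α y)))).snd
      = MσLAt 𝕜 (ctr d L) (Zf 𝕜 (R1g α W) (R1g α V)) (Zb 𝕜 (R1g α W) (R1g α V)) (Zf 𝕜 0 0) (Zb 𝕜 0 0) (upF (R1g α B)) L μ y
        + MσGAt 𝕜 (ctr d L) (Zf 𝕜 (R1g α W) (R1g α V)) (Zb 𝕜 (R1g α W) (R1g α V)) (DR (𝕜 := 𝕜) α W V B)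
            (Zf 𝕜 0 0) (Zb 𝕜 0 0) 0 L μ y := by
  rw [Mσ_sref_of_ne hL h2 h, BR_eq_upF_add_DR, MσGAt_eq_MσLAt_add]

/-- [folklore] **`μ ≠ α`: THE TRANSVERSE REFLECTION LAW OF NODE 12b's ROOTED MIXED JET `MjetAt`.** -/
theorem MjetAt_sref_of_ne {α μ : Fin d} (h : μ ≠ α) (W V B : Form1 d 𝔸) (y : Fin d → ℤ) :
    MjetAt 𝕜 (ctr d L) W V B L μ (sref α y)
      = MjetAt 𝕜 (ctr d L) (R1g α W) (R1g α V) (R1g α B) L μ y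
        + c11 (MσGAt 𝕜 (ctr d L) (Zf 𝕜 (R1g α W) (R1g α V)) (Zb 𝕜 (R1g α W) (R1g α V)) (DR (𝕜 := 𝕜) α W V B)
            (Zf 𝕜 0 0) (Zb 𝕜 0 0) 0 L μ y) := by
  rw [MjetAt, Mσ_sref_of_ne_eq_add hL h2 h, c11_add, MjetAt_eq_MjetLAt, MjetLAt_eq_c11]

end Transverse

/-! ## §3 The longitudinal law `μ = α` -/

section Longitudinal

variable {L : ℕ} (hL : Odd L) (h2 : (2 : 𝕜) ≠ 0)
include hL h2

/-- [folklore] `μ = α`, RAW FORM: the two-background σ-jet of the reflected letters at `(α, y)` is MINUS the original σ-jet at the partner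
bond `(α, y′)`, `y′ = bref α α y`, MINUS THE COMMUTATOR of the pure-fluctuation logarithm `(logT Φ).fst` with the linear background average
`Φ₀.snd` (`Φ = PhiMAt W V B L α y′`, `Φ₀ = PhiMAt 0 0 B L α y′`; leaf-05's `PhiMLAt_reflPair_self_eq_invT` twice + 33D's
`logT_invT_mul_invT_invT`; the reference has trivial group part, `fst_PhiMAt_zero_zero`). -/
theorem Mσ_reflPair_self (α : Fin d) (W V B : Form1 d 𝔸) (y : Fin d → ℤ) :
    MσGAt 𝕜 (ctr d L) (Zf 𝕜 (R1g α W) (R1g α V)) (Zb 𝕜 (R1g α W) (R1g α V)) (BR (𝕜 := 𝕜) α W V B)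
        (Zf 𝕜 0 0) (Zb 𝕜 0 0) (upF (R1g α B)) L α y
      = -((logT 𝕜 (PhiMAt 𝕜 (ctr d L) W V B L α (bref α α y) * invT (PhiMAt 𝕜 (ctr d L) 0 0 B L α (bref α α y)))).snd
          + ((logT 𝕜 (PhiMAt 𝕜 (ctr d L) W V B L α (bref α α y))).fst * (PhiMAt 𝕜 (ctr d L) 0 0 B L α (bref α α y)).snd
              - (PhiMAt 𝕜 (ctr d L) 0 0 B L α (bref α α y)).snd * (logT 𝕜 (PhiMAt 𝕜 (ctr d L) W V B L α (bref α α y))).fst)) := by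
  have hΦ : AveragingThirdJet.augR 𝕜 (PhiMAt 𝕜 (ctr d L) W V B L α (bref α α y)) = 1 :=
    aug_PhiGAt_eq_one (augR_Gm W V B) (augR_Gmb W V B) (ctr d L) L α _
  have hΦ₀ : AveragingThirdJet.augR 𝕜 (PhiMAt 𝕜 (ctr d L) 0 0 B L α (bref α α y)) = 1 :=
    aug_PhiGAt_eq_one (augR_Gm 0 0 B) (augR_Gmb 0 0 B) (ctr d L) L α _
  have h0 : (PhiMAt 𝕜 (ctr d L) 0 0 B L α (bref α α y)).fst = 1 := fst_PhiMAt_zero_zero _ B L α _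
  have hB := BR_zero_zero (𝕜 := 𝕜) α B
  rw [MσGAt, ← reflPair_Zf_Zb, ← reflPair_Zb_Zf, ← hB, ← R1g_zero (R := 𝔸) α, ← reflPair_Zf_Zb, ← reflPair_Zb_Zf, R1g_zero,
    PhiMLAt_reflPair_self_eq_invT hL h2, PhiMLAt_reflPair_self_eq_invT hL h2,
    logT_invT_mul_invT_invT (nil4_augR (𝕜 := 𝕜)) h2 hΦ hΦ₀, snd_neg_invT_mul_mul h0, fst_logT, fst_logT, dfst_mul,
    fst_invT_of_fst_eq_one h0, mul_one]

/-- [folklore] **`μ = α`: THE LONGITUDINAL REFLECTION LAW OF NODE 12b's ROOTED MIXED JET `MjetAt`** (original side solved): with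
`y′ = bref α α y`, `w, v, b̃ = R1g α W, R1g α V, R1g α B`,
`MjetAt W V B L α y′ = −( MjetAt w v b̃ L α y + c11 (MσGAt (Zf w v) (Zb w v) DR (Zf 0 0) (Zb 0 0) 0 L α y) + c11 [ (logT Φ).fst, Φ₀.snd ] )`. -/
theorem MjetAt_bref_self (α : Fin d) (W V B : Form1 d 𝔸) (y : Fin d → ℤ) :
    MjetAt 𝕜 (ctr d L) W V B L α (bref α α y)
      = -(MjetAt 𝕜 (ctr d L) (R1g α W) (R1g α V) (R1g α B) L α y
          + c11 (MσGAt 𝕜 (ctr d L) (Zf 𝕜 (R1g α W) (R1g α V)) (Zb 𝕜 (R1g α W) (R1g α V)) (DR (𝕜 := 𝕜) α W V B)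
              (Zf 𝕜 0 0) (Zb 𝕜 0 0) 0 L α y)
          + c11 ((logT 𝕜 (PhiMAt 𝕜 (ctr d L) W V B L α (bref α α y))).fst * (PhiMAt 𝕜 (ctr d L) 0 0 B L α (bref α α y)).snd
              - (PhiMAt 𝕜 (ctr d L) 0 0 B L α (bref α α y)).snd * (logT 𝕜 (PhiMAt 𝕜 (ctr d L) W V B L α (bref α α y))).fst)) := by
  have h := Mσ_reflPair_self (𝕜 := 𝕜) hL h2 α W V B y
  rw [BR_eq_upF_add_DR, MσGAt_eq_MσLAt_add] at h
  have hc := congrArg c11 h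
  rw [c11_add, ← MjetLAt_eq_c11, ← MjetAt_eq_MjetLAt, c11_neg, c11_add] at hc
  rw [MjetAt, hc, neg_add, neg_neg, add_assoc, add_neg_cancel, add_zero]

end Longitudinal

/-! ## §4 The axis correction in components and the contact expansion -/

section Components

open Classical in
/-- [folklore] The `τ₁`-component of `DR`: `[b̃, w]` on the axis. -/
noncomputable def D1R (α : Fin d) (W _V B : Form1 d 𝔸) : Form1 d 𝔸 := fun κ x =>
  if κ = α then R1g α B κ x * R1g α W κ x - R1g α W κ x * R1g α B κ x else 0

open Classical in
/-- [folklore] The `τ₂`-component of `DR`: `[b̃, v]` on the axis. -/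
noncomputable def D2R (α : Fin d) (_W V B : Form1 d 𝔸) : Form1 d 𝔸 := fun κ x =>
  if κ = α then R1g α B κ x * R1g α V κ x - R1g α V κ x * R1g α B κ x else 0

open Classical in
/-- [folklore] The `τ₁τ₂`-component of `DR`: `½{w,v}·b̃ + b̃·½{w,v} − w b̃ v − v b̃ w` on the axis. -/
noncomputable def D12R (α : Fin d) (W V B : Form1 d 𝔸) : Form1 d 𝔸 := fun κ x =>
  if κ = α then
    (2 : 𝕜)⁻¹ • (R1g α W κ x * R1g α V κ x + R1g α V κ x * R1g α W κ x) * R1g α B κ x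
      + R1g α B κ x * ((2 : 𝕜)⁻¹ • (R1g α W κ x * R1g α V κ x + R1g α V κ x * R1g α W κ x))
      - R1g α W κ x * R1g α B κ x * R1g α V κ x - R1g α V κ x * R1g α B κ x * R1g α W κ x
  else 0

/-- [folklore] `mk a b c e − ι a = τ₁·ι b + τ₂·ι c + τ₁τ₂·ι e`. -/
theorem mk_sub_ι (a b c e : 𝔸) : (mk a b c e - ι a : Tau 𝔸) = τ₁ * ι b + τ₂ * ι c + τ12 * ι e :=
  ext4 (by simp [mk, ι, c00, τ₁, τ₂, τ12]) (by simp [mk, ι, c10, τ₁, τ₂, τ12]) (by simp [mk, ι, c01, τ₁, τ₂, τ12])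
    (by simp [mk, ι, c11, τ₁, τ₂, τ12])

/-- [folklore] **THE AXIS CORRECTION IN COMPONENTS**: `DR = τ₁·ι D1R + τ₂·ι D2R + τ₁τ₂·ι D12R`. -/
theorem DR_eq (α : Fin d) (W V B : Form1 d 𝔸) :
    DR (𝕜 := 𝕜) α W V B
      = (fun κ x => τ₁ * ι (D1R α W V B κ x)) + (fun κ x => τ₂ * ι (D2R α W V B κ x))
          + (fun κ x => τ12 * ι (D12R (𝕜 := 𝕜) α W V B κ x)) := by
  classical
  funext κ x
  by_cases h : κ = α
  · subst h
    rw [DR_self, Zb_mul_ι_mul_Zf, mk_sub_ι]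
    simp [D1R, D2R, D12R]
  · simp only [Pi.add_apply, DR_of_ne h, D1R, D2R, D12R, if_neg h, ι_zero, mul_zero, add_zero]

/-- [folklore] **THE CONTACT EXPANSION** of the correction jet:
`c11 (MσGAt … DR … 0) = c01 (MσGAt … (upF D1R) … 0) + c10 (MσGAt … (upF D2R) … 0) + c00 (MσGAt … (upF D12R) … 0)`. -/
theorem c11_MσGAt_DR (ρ : Fin d → ℤ) (Z Zb' Z₀ Zb₀ : Form1 d (Tau 𝔸)) (α : Fin d) (W V B : Form1 d 𝔸) (L : ℕ) (μ : Fin d)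
    (y : Fin d → ℤ) :
    c11 (MσGAt 𝕜 ρ Z Zb' (DR (𝕜 := 𝕜) α W V B) Z₀ Zb₀ 0 L μ y)
      = c01 (MσGAt 𝕜 ρ Z Zb' (upF (D1R α W V B)) Z₀ Zb₀ 0 L μ y)
        + c10 (MσGAt 𝕜 ρ Z Zb' (upF (D2R α W V B)) Z₀ Zb₀ 0 L μ y)
        + c00 (MσGAt 𝕜 ρ Z Zb' (upF (D12R (𝕜 := 𝕜) α W V B)) Z₀ Zb₀ 0 L μ y) := by
  have e1 : (fun κ x => τ₁ * ι (D1R α W V B κ x)) = fun κ x => τ₁ * upF (D1R α W V B) κ x := rfl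
  have e2 : (fun κ x => τ₂ * ι (D2R α W V B κ x)) = fun κ x => τ₂ * upF (D2R α W V B) κ x := rfl
  have e3 : (fun κ x => τ12 * ι (D12R (𝕜 := 𝕜) α W V B κ x)) = fun κ x => τ12 * upF (D12R (𝕜 := 𝕜) α W V B) κ x := rfl
  rw [DR_eq, MσGAt_add_zero, MσGAt_add_zero, e1, e2, e3, MσGAt_mul_central_zero τ₁ τ₁_comm, MσGAt_mul_central_zero τ₂ τ₂_comm,
    MσGAt_mul_central_zero τ12 τ12_comm, c11_add, c11_add, c11_τ₁_mul, c11_τ₂_mul, c11_τ12_mul]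

end Components

end Summit.QuantumFields.BalabanUV.Beta.RootedMixedJetReflectionLaw
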